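import Summits.QuantumFields.BalabanUV.Beta.GAN24.DerivativeRateTransferAnalytic
import Literature.MathematicalPhysics.QuantumFieldTheory.Balaban1983to89.Beta.CompositionSingular

/-!
# `BalabanUV.Beta.GAN24.DerivativeRateTransferLoewnerKKT` — binder row G-an2-4 ∕ (CONV-C), route R6 «VALUES, NOT DERIVATIVES», PART 18:
# THE LOEWNER SOURCE OF S1 IN an1's BORDERED LETTERS (`Composition.kkt`, `CompositionSingular.effForm ∕ minOp`; real data; the fine form only
# POSITIVE SEMIDEFINITE — gauge-degenerate ∕ massless fine forms allowed — with the BORDERED matrix nonsingular): (STAB) + (CONS) ⟹ the entry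
# one-step rate of the effective forms whose u-derivatives ARE PART 12's `dEffForm` rows, and the leg split; joined to PART 7 (unit b2b-balaban-gan24-p3, gen 36; v1)

NOT IN PRINT; OUR PROOF (for the ROUTE; [folklore] real linear algebra over an1's `CompositionSingular` identities BY NAME — `mul_minOp` (`Qℋ = 1`),
`mul_minOp_eq` (Euler–Lagrange `Hℋ = Qᵀ𝒮`), `transpose_minOp_mul_mul_minOp` (`ℋᵀHℋ = 𝒮`, no invertibility of `H`), `minOpL_eq_transpose` (symmetry) —
and PART 7's `deriv_step_rateω`).  HONEST FRAMING (cell contract, verbatim): «discharging `BetaPertH` makes Bałaban's UV stability UNCONDITIONAL — a real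
constructive-QFT result; it is NOT the continuum limit and NOT the Clay problem.»  HONEST DEPENDENCY (verbatim): «continuum YM on T⁴ ⇐ BetaPertH ∧ nine
spine estimates (0/9 proved); BetaPertH ⇐ (D1) ∧ (D4) ∧ CAP+tail; G-an2-4 gates asym, D1 and NE2/3/4.»

WHY THIS FILE.  PARTs 15–17 state the Loewner source of S1 in p3's `PropagatorWoodburyFibre` letters, which need the fine form INVERTIBLE
(`Δ_eff = (QH⁻¹Qᴴ)⁻¹`); the identification with an1's `kkt`-blocks was left to the consumer (`hFeff`).  an1's (MF′) algebra — the vocabulary of PARTs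
12–14, whose `dEffForm` rows ARE the u-derivative rows route R6 serves — allows a SINGULAR fine form (gauge-degenerate, massless) as long as the bordered
matrix `kkt H Q = [[H, Qᵀ],[Q, 0]]` is nonsingular (`CompositionSingular`, «the singular-Δ case»).  THIS FILE re-proves PART 15 §3 and PART 17 §1 directly in
those letters over `ℝ`, from three of an1's identities and nothing else, with the fine forms only POSITIVE SEMIDEFINITE: the variational inequality, the
monotone step under (STAB), the diagonal step under (CONS), the exact leg split, the entry rate, and the join with PART 7 by realification of the
entries.  No `hFeff` bookkeeping remains: the matrix family of §5 IS `s ↦ 𝒮(H_k(s), Q_k(s))`.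

WHAT THIS FILE PROVES (0 sorry, 0 `def`, nothing cited; `𝕜 = ℝ`):
* §1 `abs_apply_le_of_diag_le` — real PSD + diagonal `≤ δ` ⟹ `|D_{ab}| ≤ δ`; `abs_step_apply_le_of_diag` (tower form).
* §2 `dotProduct_effForm_eq_energy` (`⟨v, 𝒮v⟩ = ⟨ℋv, Hℋv⟩`), `energy_split` (`Qu = v` ⟹ `⟨u,Hu⟩ = ⟨v,𝒮v⟩ + ⟨u − ℋv, H(u − ℋv)⟩`, EXACT — the
  background-field split at one vector), **`dotProduct_effForm_le_trial`** (`H` PSD ⟹ `⟨v,𝒮v⟩ ≤ ⟨u,Hu⟩` for every admissible `u`).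
* §3 **`effForm_step_posSemidef_of_stab`** ((STAB) `Qfᵀ H Qf ≤ H′`, `Q′ = Q·Qf` ⟹ `0 ≤ 𝒮′ − 𝒮`), **`effForm_step_diag_le_cons`** (`Q′P = Q` ⟹
  `𝒮′_{yy} − 𝒮_{yy} ≤ ⟨ℋe_y, (PᵀH′P − H)ℋe_y⟩`), **`leg_energy_eq_cons_sub_step`** (`⟨Pℋe_y − ℋ′e_y, H′(·)⟩ = (CONS) − (𝒮′_{yy} − 𝒮_{yy})`, EXACT).
* §4 THE TOWER END **`effForm_entry_step_rate_of_stab_of_cons`** — PSD fine forms `H j`, nonsingular bordered matrices, `Qc (j+1) = Qc j · Qf j`,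
  `Qc (j+1) · P j = Qc j`, (STAB_j), (CONS_{j,y}) `≤ cst·θ^j` ⟹ `|𝒮_{j+1}(a,b) − 𝒮_j(a,b)| ≤ cst·θ^j` ∀ j a b, and `leg_energy_step_rate_of_stab_of_cons`.
* §5 THE JOIN WITH PART 7 **`deriv_effForm_entry_step_rateω`** — parametrised real towers over the background segment `[0, s₁]` + a complex family
  `F j z` whose entries are holomorphic and bounded on `ball 0 ρ` and REALIFY `𝒮(H_j(s), Qc_j(s))_{ab}` on the segment ⟹ the u-derivative rows inherit the rate.
* §6 THE ROBUST FORM (stability only up to a factor `1 + ε_j`, as expected with a background where covariant averaging is energy-stable up to curvature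
  terms): `effForm_step_posSemidef_of_stabSlack` (`Qfᵀ H Qf ≤ (1+ε)H′ ⟹ 𝒮 ≤ (1+ε)𝒮′`), `abs_effForm_step_le_of_stabSlack_of_cons` (`|𝒮′_{ab} − 𝒮_{ab}| ≤
  (1+ε)κ + 2εB`), **`effForm_entry_step_rate_of_stabSlack_of_cons`** (`ε_j = cε·θ^j`, (CONS) `≤ cst·θ^j`, `|𝒮_j| ≤ B` ⟹ rate `((1+cε)cst + 2cεB)·θ^j`).
WHAT IT DOES NOT DO: discharge (STAB)∕(CONS) for Bałaban's operators; assert which tower is B12's (S2(ii)); entry readings of fine legs.  SUPPLIER work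
on route R6 (rank 2, REDUCTION, no seat); no consumer of record; NEVER «G-an2-4 closed»; NOT (CONV-C), NOT D1, NOT `BetaPertH`, NOT continuum, NOT Clay.
-/

noncomputable section

open Set Metric Matrix

namespace Summit.QuantumFields.BalabanUV.Beta.GAN24.DerivativeRateTransferLoewnerKKT

open Literature.MathematicalPhysics.QuantumFieldTheory.Balaban1983to89.Beta.Composition (kkt)
open Literature.MathematicalPhysics.QuantumFieldTheory.Balaban1983to89.Beta.CompositionSingular (effForm minOp mul_minOp mul_minOp_eq
  transpose_minOp_mul_mul_minOp minOpL_eq_transpose)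
open Summit.QuantumFields.BalabanUV.Beta.GAN24.DerivativeRateTransferAnalytic (deriv_step_rateω)

/-! ## §1 Real PSD matrices: small diagonal ⟹ small entries -/

section PSD

variable {n : Type*} {D : Matrix n n ℝ}

/-- **SMALL DIAGONAL ⟹ SMALL ENTRIES (real PSD)**: `D_{ab}² ≤ D_{aa}D_{bb}` by the `2 × 2` principal minor. [folklore] -/
theorem abs_apply_le_of_diag_le (hD : D.PosSemidef) {δ : ℝ} (hdiag : ∀ a, D a a ≤ δ) (a b : n) : |D a b| ≤ δ := by
  have hS : (D.submatrix ![a, b] ![a, b]).PosSemidef := hD.submatrix _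
  have hdet := hS.det_nonneg
  rw [Matrix.det_fin_two] at hdet
  simp only [Matrix.submatrix_apply, Matrix.cons_val_zero, Matrix.cons_val_one] at hdet
  have hab : D a b = D b a := by simpa using hD.isHermitian.apply b a
  have ha : 0 ≤ D a a := hD.diag_nonneg
  have hb : 0 ≤ D b b := hD.diag_nonneg
  rw [← hab] at hdet
  have h2 : |D a b| ^ 2 ≤ δ ^ 2 := by rw [sq_abs]; nlinarith [hdiag a, hdiag b]
  exact (pow_le_pow_iff_left₀ (abs_nonneg _) (ha.trans (hdiag a)) two_ne_zero).mp h2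

variable {P : ℕ → Matrix n n ℝ} {c θ : ℝ}

/-- **INCREASING REAL TOWER: PSD STEPS + DIAGONAL RATE ⟹ ENTRY RATE.** [folklore] -/
theorem abs_step_apply_le_of_diag (hstep : ∀ k, (P (k + 1) - P k).PosSemidef)
    (hdiag : ∀ k a, (P (k + 1) - P k) a a ≤ c * θ ^ k) : ∀ k a b, |P (k + 1) a b - P k a b| ≤ c * θ ^ k := fun k a b => by
  simpa only [Matrix.sub_apply] using abs_apply_le_of_diag_le (hstep k) (hdiag k) a b

end PSD

/-! ## §2 The variational inequality in an1's bordered letters (fine form only PSD; bordered matrix nonsingular) -/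

section Variational

variable {ν μ : Type*} [Fintype ν] [Fintype μ] [DecidableEq ν] [DecidableEq μ]
variable {H : Matrix ν ν ℝ} {Q : Matrix μ ν ℝ}

omit [Fintype ν] [Fintype μ] [DecidableEq ν] [DecidableEq μ] in
/-- [folklore] a real positive semidefinite matrix is symmetric. -/
theorem transpose_eq_of_posSemidef {A : Matrix ν ν ℝ} (hA : A.PosSemidef) : Aᵀ = A := by
  have h := hA.isHermitian.eq
  rwa [Matrix.conjTranspose_eq_transpose_of_trivial] at h

omit [DecidableEq μ] in
/-- [folklore] moving a real matrix across the dot product: `⟨Mv, w⟩ = ⟨v, Mᵀw⟩`. -/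
theorem mulVec_dotProduct_eq {m : Type*} [Fintype m] (M : Matrix m μ ℝ) (v : μ → ℝ) (w : m → ℝ) :
    (M *ᵥ v) ⬝ᵥ w = v ⬝ᵥ (Mᵀ *ᵥ w) := by
  rw [← vecMul_transpose, ← dotProduct_mulVec]

/-- **`⟨v, 𝒮v⟩ = ⟨ℋv, Hℋv⟩`** (an1's value identity `ℋᵀHℋ = 𝒮` at one vector; no invertibility, no symmetry of `H`). [folklore] -/
theorem dotProduct_effForm_eq_energy (h : IsUnit (kkt H Q).det) (v : μ → ℝ) :
    v ⬝ᵥ (effForm H Q *ᵥ v) = (minOp H Q *ᵥ v) ⬝ᵥ (H *ᵥ (minOp H Q *ᵥ v)) := by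
  rw [← transpose_minOp_mul_mul_minOp H Q h, mulVec_dotProduct_eq, mulVec_mulVec, mulVec_mulVec, Matrix.mul_assoc]

/-- `Q(ℋv) = v`. [folklore] -/
theorem mulVec_minOp (h : IsUnit (kkt H Q).det) (v : μ → ℝ) : Q *ᵥ (minOp H Q *ᵥ v) = v := by
  rw [mulVec_mulVec, mul_minOp H Q h, one_mulVec]

/-- fluctuations do no first-order work: `Qz = 0` ⟹ `⟨z, H(ℋv)⟩ = 0` (Euler–Lagrange `Hℋ = Qᵀ𝒮`). [folklore] -/
theorem dotProduct_mulVec_minOp_eq_zero (h : IsUnit (kkt H Q).det) {z : ν → ℝ} (hz : Q *ᵥ z = 0) (v : μ → ℝ) :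
    z ⬝ᵥ (H *ᵥ (minOp H Q *ᵥ v)) = 0 := by
  rw [mulVec_mulVec, mul_minOp_eq H Q h, ← mulVec_mulVec, ← mulVec_dotProduct_eq, hz, zero_dotProduct]

/-- **THE BACKGROUND-FIELD SPLIT AT ONE VECTOR, EXACT**: `H` symmetric, bordered matrix nonsingular, `Qu = v` ⟹
`⟨u, Hu⟩ = ⟨v, 𝒮v⟩ + ⟨u − ℋv, H(u − ℋv)⟩` (an1's `backgroundField_split` pattern; the cross term dies by Euler–Lagrange). [folklore] -/
theorem energy_split (hH : Hᵀ = H) (h : IsUnit (kkt H Q).det) {u : ν → ℝ} {v : μ → ℝ} (hu : Q *ᵥ u = v) :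
    u ⬝ᵥ (H *ᵥ u) = v ⬝ᵥ (effForm H Q *ᵥ v) + (u - minOp H Q *ᵥ v) ⬝ᵥ (H *ᵥ (u - minOp H Q *ᵥ v)) := by
  set m : ν → ℝ := minOp H Q *ᵥ v with hm
  have hz : Q *ᵥ (u - m) = 0 := by rw [mulVec_sub, hu, hm, mulVec_minOp h, sub_self]
  have h1 : (u - m) ⬝ᵥ (H *ᵥ m) = 0 := by rw [hm]; exact dotProduct_mulVec_minOp_eq_zero h hz v
  have h2 : m ⬝ᵥ (H *ᵥ (u - m)) = 0 := by
    rw [dotProduct_mulVec, ← mulVec_transpose, hH, ← h1, dotProduct_comm]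
  have e : u = m + (u - m) := by abel
  rw [dotProduct_effForm_eq_energy h v, ← hm]
  conv_lhs => rw [e]
  rw [mulVec_add, add_dotProduct, dotProduct_add, dotProduct_add, h1, h2]
  ring

/-- **THE EFFECTIVE FORM IS BELOW THE ENERGY OF EVERY ADMISSIBLE TRIAL FIELD** (fine form only PSD): `Qu = v` ⟹ `⟨v, 𝒮v⟩ ≤ ⟨u, Hu⟩`. [folklore] -/
theorem dotProduct_effForm_le_trial (hH : H.PosSemidef) (h : IsUnit (kkt H Q).det) {u : ν → ℝ} {v : μ → ℝ} (hu : Q *ᵥ u = v) :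
    v ⬝ᵥ (effForm H Q *ᵥ v) ≤ u ⬝ᵥ (H *ᵥ u) := by
  rw [energy_split (transpose_eq_of_posSemidef hH) h hu]
  have := hH.dotProduct_mulVec_nonneg (u - minOp H Q *ᵥ v)
  simp only [star_trivial] at this
  linarith

end Variational

/-! ## §3 Two levels: the monotone step under (STAB), the diagonal step under (CONS), the exact leg split -/

section TwoLevels

variable {c ν ν' : Type*} [Fintype c] [Fintype ν] [Fintype ν'] [DecidableEq c] [DecidableEq ν] [DecidableEq ν']
variable {H : Matrix ν ν ℝ} {Q : Matrix c ν ℝ} {H' : Matrix ν' ν' ℝ} {Q' : Matrix c ν' ℝ} {Qf : Matrix ν ν' ℝ} {P : Matrix ν' ν ℝ}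

/-- **(STAB) ⟹ THE EFFECTIVE FORMS INCREASE** (fine forms only PSD; bordered matrices nonsingular; `Q′ = Q·Qf`): `0 ≤ 𝒮(H′,Q′) − 𝒮(H,Q)`.
Proof at one vector: `⟨v,𝒮v⟩ ≤ ⟨Qf ℋ′v, H Qf ℋ′v⟩ ≤ ⟨ℋ′v, H′ℋ′v⟩ = ⟨v,𝒮′v⟩`. [our proof] -/
theorem effForm_step_posSemidef_of_stab (hH : H.PosSemidef) (hH' : H'.PosSemidef) (h : IsUnit (kkt H Q).det)
    (h' : IsUnit (kkt H' Q').det) (hcomp : Q' = Q * Qf) (hstab : (H' - Qfᵀ * H * Qf).PosSemidef) :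
    (effForm H' Q' - effForm H Q).PosSemidef := by
  have hS : (effForm H Q)ᵀ = effForm H Q := (minOpL_eq_transpose H Q (transpose_eq_of_posSemidef hH)).2.2
  have hS' : (effForm H' Q')ᵀ = effForm H' Q' := (minOpL_eq_transpose H' Q' (transpose_eq_of_posSemidef hH')).2.2
  refine PosSemidef.of_dotProduct_mulVec_nonneg ?_ fun v => ?_
  · rw [Matrix.IsHermitian, Matrix.conjTranspose_eq_transpose_of_trivial, transpose_sub, hS, hS']
  · simp only [star_trivial, sub_mulVec, dotProduct_sub, sub_nonneg]
    set u' : ν' → ℝ := minOp H' Q' *ᵥ v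
    have hadm : Q *ᵥ (Qf *ᵥ u') = v := by rw [mulVec_mulVec, ← hcomp]; exact mulVec_minOp h' v
    have h1 := dotProduct_effForm_le_trial hH h hadm
    have h2 := hstab.dotProduct_mulVec_nonneg u'
    simp only [star_trivial, sub_mulVec, dotProduct_sub, sub_nonneg] at h2
    rw [dotProduct_effForm_eq_energy h' v]
    calc v ⬝ᵥ (effForm H Q *ᵥ v) ≤ (Qf *ᵥ u') ⬝ᵥ (H *ᵥ (Qf *ᵥ u')) := h1
      _ = u' ⬝ᵥ ((Qfᵀ * H * Qf) *ᵥ u') := by rw [mulVec_dotProduct_eq, mulVec_mulVec, mulVec_mulVec, Matrix.mul_assoc]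
      _ ≤ u' ⬝ᵥ (H' *ᵥ u') := h2

/-- [folklore] the quadratic form at a unit vector is the diagonal entry. -/
theorem single_dotProduct_mulVec_single (E : Matrix c c ℝ) (y : c) :
    (Pi.single y (1 : ℝ)) ⬝ᵥ (E *ᵥ Pi.single y 1) = E y y := by
  rw [single_dotProduct, one_mul, Matrix.mulVec_single_one, Matrix.col_apply]

/-- **(CONS) BOUNDS THE DIAGONAL STEP**: `Q′P = Q` ⟹ the prolongated minimiser `Pℋe_y` is admissible one level up and
`𝒮′_{yy} − 𝒮_{yy} ≤ ⟨ℋe_y, (PᵀH′P − H)ℋe_y⟩`. [our proof] -/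
theorem effForm_step_diag_le_cons (hH' : H'.PosSemidef) (h : IsUnit (kkt H Q).det) (h' : IsUnit (kkt H' Q').det)
    (hPQ : Q' * P = Q) (y : c) :
    effForm H' Q' y y - effForm H Q y y ≤
      (minOp H Q *ᵥ Pi.single y 1) ⬝ᵥ ((Pᵀ * H' * P - H) *ᵥ (minOp H Q *ᵥ Pi.single y 1)) := by
  set m : ν → ℝ := minOp H Q *ᵥ Pi.single y 1 with hm
  have hadm : Q' *ᵥ (P *ᵥ m) = Pi.single y 1 := by rw [mulVec_mulVec, hPQ, hm, mulVec_minOp h]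
  have h1 := dotProduct_effForm_le_trial hH' h' hadm
  have h2 : effForm H Q y y = m ⬝ᵥ (H *ᵥ m) := by rw [hm, ← dotProduct_effForm_eq_energy h, single_dotProduct_mulVec_single]
  rw [single_dotProduct_mulVec_single] at h1
  have h3 : (P *ᵥ m) ⬝ᵥ (H' *ᵥ (P *ᵥ m)) = m ⬝ᵥ ((Pᵀ * H' * P) *ᵥ m) := by
    rw [mulVec_dotProduct_eq, mulVec_mulVec, mulVec_mulVec, Matrix.mul_assoc]
  rw [h2, sub_mulVec, dotProduct_sub, ← h3]
  linarith

/-- **THE LEG SPLIT, EXACT**: `H′` symmetric, `Q′P = Q` ⟹ `⟨Pℋe_y − ℋ′e_y, H′(Pℋe_y − ℋ′e_y)⟩ = ⟨ℋe_y, (PᵀH′P − H)ℋe_y⟩ − (𝒮′_{yy} − 𝒮_{yy})`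
— the leg's one-step defect in the new fine energy norm is (CONS) minus the effective-form step. [our proof] -/
theorem leg_energy_eq_cons_sub_step (hH' : H'ᵀ = H') (h : IsUnit (kkt H Q).det) (h' : IsUnit (kkt H' Q').det)
    (hPQ : Q' * P = Q) (y : c) :
    (P *ᵥ (minOp H Q *ᵥ Pi.single y 1) - minOp H' Q' *ᵥ Pi.single y 1) ⬝ᵥ
        (H' *ᵥ (P *ᵥ (minOp H Q *ᵥ Pi.single y 1) - minOp H' Q' *ᵥ Pi.single y 1)) =
      (minOp H Q *ᵥ Pi.single y 1) ⬝ᵥ ((Pᵀ * H' * P - H) *ᵥ (minOp H Q *ᵥ Pi.single y 1)) -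
        (effForm H' Q' y y - effForm H Q y y) := by
  set m : ν → ℝ := minOp H Q *ᵥ Pi.single y 1 with hm
  have hadm : Q' *ᵥ (P *ᵥ m) = Pi.single y 1 := by rw [mulVec_mulVec, hPQ, hm, mulVec_minOp h]
  have hsplit := energy_split hH' h' hadm
  rw [single_dotProduct_mulVec_single] at hsplit
  have h2 : effForm H Q y y = m ⬝ᵥ (H *ᵥ m) := by rw [hm, ← dotProduct_effForm_eq_energy h, single_dotProduct_mulVec_single]
  have h3 : (P *ᵥ m) ⬝ᵥ (H' *ᵥ (P *ᵥ m)) = m ⬝ᵥ ((Pᵀ * H' * P) *ᵥ m) := by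
    rw [mulVec_dotProduct_eq, mulVec_mulVec, mulVec_mulVec, Matrix.mul_assoc]
  rw [h2, sub_mulVec, dotProduct_sub, ← h3]
  linarith

end TwoLevels

/-! ## §4 The tower END in an1's letters -/

section Tower

variable {c : Type*} [Fintype c] [DecidableEq c]
variable {ι : ℕ → Type*} [∀ j, Fintype (ι j)] [∀ j, DecidableEq (ι j)]
variable {H : ∀ j, Matrix (ι j) (ι j) ℝ} {Qf : ∀ j, Matrix (ι j) (ι (j + 1)) ℝ} {Qc : ∀ j, Matrix c (ι j) ℝ}
variable {P : ∀ j, Matrix (ι (j + 1)) (ι j) ℝ} {cst θ : ℝ}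

/-- **`effForm_entry_step_rate_of_stab_of_cons` — (STAB) + (CONS) ⟹ THE ENTRY ONE-STEP RATE OF an1's EFFECTIVE FORMS** [our proof]: PSD fine
forms `H j` (singular allowed), nonsingular bordered matrices `kkt (H j) (Qc j)`, `Qc (j+1) = Qc j · Qf j`, `Qc (j+1) · P j = Qc j`,
(STAB_j) `(Qf j)ᵀ H_j (Qf j) ≤ H_{j+1}`, (CONS_{j,y}) `⟨ℋ_j e_y, ((P j)ᵀ H_{j+1} (P j) − H_j) ℋ_j e_y⟩ ≤ cst·θ^j` ⟹
`|𝒮_{j+1}(a,b) − 𝒮_j(a,b)| ≤ cst·θ^j` for all `j, a, b`. -/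
theorem effForm_entry_step_rate_of_stab_of_cons (hH : ∀ j, (H j).PosSemidef) (hk : ∀ j, IsUnit (kkt (H j) (Qc j)).det)
    (hcomp : ∀ j, Qc (j + 1) = Qc j * Qf j) (hPQ : ∀ j, Qc (j + 1) * P j = Qc j)
    (hstab : ∀ j, (H (j + 1) - (Qf j)ᵀ * H j * Qf j).PosSemidef)
    (hcons : ∀ j (y : c), (minOp (H j) (Qc j) *ᵥ Pi.single y 1) ⬝ᵥ
        (((P j)ᵀ * H (j + 1) * P j - H j) *ᵥ (minOp (H j) (Qc j) *ᵥ Pi.single y 1)) ≤ cst * θ ^ j) :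
    ∀ j (a b : c), |effForm (H (j + 1)) (Qc (j + 1)) a b - effForm (H j) (Qc j) a b| ≤ cst * θ ^ j :=
  abs_step_apply_le_of_diag (P := fun j => effForm (H j) (Qc j))
    (fun j => effForm_step_posSemidef_of_stab (hH j) (hH (j + 1)) (hk j) (hk (j + 1)) (hcomp j) (hstab j))
    (fun j y => by
      rw [Matrix.sub_apply]
      exact (effForm_step_diag_le_cons (hH (j + 1)) (hk j) (hk (j + 1)) (hPQ j) y).trans (hcons j y))

/-- **`leg_energy_step_rate_of_stab_of_cons` — THE LEGS IN ENERGY CURRENCY FROM THE SAME DATUM** [our proof]: under the same hypotheses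
`⟨P_jℋ_j e_y − ℋ_{j+1}e_y, H_{j+1}(P_jℋ_j e_y − ℋ_{j+1}e_y)⟩ ≤ cst·θ^j` for all `j, y`. -/
theorem leg_energy_step_rate_of_stab_of_cons (hH : ∀ j, (H j).PosSemidef) (hk : ∀ j, IsUnit (kkt (H j) (Qc j)).det)
    (hcomp : ∀ j, Qc (j + 1) = Qc j * Qf j) (hPQ : ∀ j, Qc (j + 1) * P j = Qc j)
    (hstab : ∀ j, (H (j + 1) - (Qf j)ᵀ * H j * Qf j).PosSemidef)
    (hcons : ∀ j (y : c), (minOp (H j) (Qc j) *ᵥ Pi.single y 1) ⬝ᵥ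
        (((P j)ᵀ * H (j + 1) * P j - H j) *ᵥ (minOp (H j) (Qc j) *ᵥ Pi.single y 1)) ≤ cst * θ ^ j) :
    ∀ j (y : c), (P j *ᵥ (minOp (H j) (Qc j) *ᵥ Pi.single y 1) - minOp (H (j + 1)) (Qc (j + 1)) *ᵥ Pi.single y 1) ⬝ᵥ
        (H (j + 1) *ᵥ (P j *ᵥ (minOp (H j) (Qc j) *ᵥ Pi.single y 1) - minOp (H (j + 1)) (Qc (j + 1)) *ᵥ Pi.single y 1)) ≤
      cst * θ ^ j := fun j y => by
  rw [leg_energy_eq_cons_sub_step (transpose_eq_of_posSemidef (hH (j + 1))) (hk j) (hk (j + 1)) (hPQ j) y]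
  have hmono : 0 ≤ effForm (H (j + 1)) (Qc (j + 1)) y y - effForm (H j) (Qc j) y y := by
    have := (effForm_step_posSemidef_of_stab (hH j) (hH (j + 1)) (hk j) (hk (j + 1)) (hcomp j) (hstab j)).diag_nonneg (i := y)
    rwa [Matrix.sub_apply] at this
  linarith [hcons j y]

end Tower

/-! ## §5 The join with PART 7: an1's effective forms along the real background segment + S2 ⟹ the u-derivative rows -/

section Join

variable {c : Type*} [Fintype c] [DecidableEq c]
variable {ι : ℕ → Type*} [∀ j, Fintype (ι j)] [∀ j, DecidableEq (ι j)]
variable {H : ∀ j, ℝ → Matrix (ι j) (ι j) ℝ} {Qf : ∀ j, ℝ → Matrix (ι j) (ι (j + 1)) ℝ} {Qc : ∀ j, ℝ → Matrix c (ι j) ℝ}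
variable {P : ∀ j, ℝ → Matrix (ι (j + 1)) (ι j) ℝ} {F : ℕ → ℂ → Matrix c c ℂ} {ρ s₁ B cst θ : ℝ}

/-- **`deriv_effForm_entry_step_rateω` — THE END IN an1's LETTERS** [our proof]: real towers at each background `s ∈ [0, s₁]` (PSD fine forms,
nonsingular bordered matrices, `Qc (j+1) s = Qc j s · Qf j s`, `Qc (j+1) s · P j s = Qc j s`, (STAB)(s), (CONS)(s) `≤ cst·θ^j` uniformly in `s`;
`0 < cst`, `0 < θ`), and a complex family `F j : ℂ → Matrix c c ℂ` with entries holomorphic and bounded by `B` on `ball 0 ρ` (`0 < s₁`,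
`s₁·cosh 1 < ρ`) that REALIFIES an1's effective forms on the segment (`(F j s)_{ab} = 𝒮(H_j(s), Qc_j(s))_{ab}`) ⟹ for every `r ∈ ]0,1]`, `k, a, b`:
`‖∂_z(F (k+1))_{ab}(0) − ∂_z(F k)_{ab}(0)‖ ≤ 25·(2B)^r∕(s₁r²)·cst^{1−r}·(θ^{1−r})^k` — the derivative rows PART 12 names `dEffForm`, when `F` is the
`kkt`-inverse corner along a holomorphic background family. -/
theorem deriv_effForm_entry_step_rateω (hs₁ : 0 < s₁) (hs₁ρ : s₁ * Real.cosh 1 < ρ)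
    (hF : ∀ k a b, DifferentiableOn ℂ (fun z => F k z a b) (ball (0 : ℂ) ρ))
    (hB : ∀ k a b, ∀ z ∈ ball (0 : ℂ) ρ, ‖F k z a b‖ ≤ B)
    (hFeff : ∀ j (s : ℝ), 0 ≤ s → s ≤ s₁ → ∀ a b, F j (s : ℂ) a b = ((effForm (H j s) (Qc j s) a b : ℝ) : ℂ))
    (hH : ∀ j (s : ℝ), 0 ≤ s → s ≤ s₁ → (H j s).PosSemidef)
    (hk : ∀ j (s : ℝ), 0 ≤ s → s ≤ s₁ → IsUnit (kkt (H j s) (Qc j s)).det)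
    (hcomp : ∀ j (s : ℝ), 0 ≤ s → s ≤ s₁ → Qc (j + 1) s = Qc j s * Qf j s)
    (hPQ : ∀ j (s : ℝ), 0 ≤ s → s ≤ s₁ → Qc (j + 1) s * P j s = Qc j s)
    (hstab : ∀ j (s : ℝ), 0 ≤ s → s ≤ s₁ → (H (j + 1) s - (Qf j s)ᵀ * H j s * Qf j s).PosSemidef)
    (hcons : ∀ j (s : ℝ), 0 ≤ s → s ≤ s₁ → ∀ y : c, (minOp (H j s) (Qc j s) *ᵥ Pi.single y 1) ⬝ᵥ
        (((P j s)ᵀ * H (j + 1) s * P j s - H j s) *ᵥ (minOp (H j s) (Qc j s) *ᵥ Pi.single y 1)) ≤ cst * θ ^ j)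
    (hc : 0 < cst) (hθ : 0 < θ) {r : ℝ} (hr : 0 < r) (hr1 : r ≤ 1) (k : ℕ) (a b : c) :
    ‖deriv (fun z => F (k + 1) z a b) 0 - deriv (fun z => F k z a b) 0‖ ≤
      25 * (2 * B) ^ r / (s₁ * r ^ 2) * cst ^ (1 - r) * (θ ^ (1 - r)) ^ k := by
  refine deriv_step_rateω (F := fun k z => F k z a b) hs₁ hs₁ρ (fun k => hF k a b) (fun k => hB k a b)
    (fun k s hs0 hs1 => ?_) hc hθ hr hr1 k
  have hrate := effForm_entry_step_rate_of_stab_of_cons (H := fun j => H j s) (Qf := fun j => Qf j s) (Qc := fun j => Qc j s)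
    (P := fun j => P j s) (fun j => hH j s hs0 hs1) (fun j => hk j s hs0 hs1) (fun j => hcomp j s hs0 hs1) (fun j => hPQ j s hs0 hs1)
    (fun j => hstab j s hs0 hs1) (fun j => hcons j s hs0 hs1) k a b
  rw [hFeff (k + 1) s hs0 hs1 a b, hFeff k s hs0 hs1 a b, ← Complex.ofReal_sub, Complex.norm_real, Real.norm_eq_abs]
  exact hrate

end Join

/-! ## §6 The ROBUST form: (STAB) only up to a factor `1 + ε_j` (as expected with a background: covariant averaging is energy-stable up to curvature
terms) — an `O(θ^j)` slack costs nothing in the exponent -/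

section Slack

variable {c ν ν' : Type*} [Fintype c] [Fintype ν] [Fintype ν'] [DecidableEq c] [DecidableEq ν] [DecidableEq ν']
variable {H : Matrix ν ν ℝ} {Q : Matrix c ν ℝ} {H' : Matrix ν' ν' ℝ} {Q' : Matrix c ν' ℝ} {Qf : Matrix ν ν' ℝ} {P : Matrix ν' ν ℝ}

/-- **(STAB-ε) ⟹ `𝒮 ≤ (1 + ε)·𝒮′`**: if the averaging is energy-stable up to a factor, `Qfᵀ H Qf ≤ (1+ε)·H′` (`Q′ = Q·Qf`, fine forms PSD, bordered
matrices nonsingular), then `0 ≤ (1+ε)·𝒮(H′,Q′) − 𝒮(H,Q)`. [our proof] -/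
theorem effForm_step_posSemidef_of_stabSlack (hH : H.PosSemidef) (hH' : H'.PosSemidef) (h : IsUnit (kkt H Q).det)
    (h' : IsUnit (kkt H' Q').det) (hcomp : Q' = Q * Qf) {ε : ℝ} (hstab : ((1 + ε) • H' - Qfᵀ * H * Qf).PosSemidef) :
    ((1 + ε) • effForm H' Q' - effForm H Q).PosSemidef := by
  have hS : (effForm H Q)ᵀ = effForm H Q := (minOpL_eq_transpose H Q (transpose_eq_of_posSemidef hH)).2.2
  have hS' : (effForm H' Q')ᵀ = effForm H' Q' := (minOpL_eq_transpose H' Q' (transpose_eq_of_posSemidef hH')).2.2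
  refine PosSemidef.of_dotProduct_mulVec_nonneg ?_ fun v => ?_
  · rw [Matrix.IsHermitian, Matrix.conjTranspose_eq_transpose_of_trivial, transpose_sub, transpose_smul, hS, hS']
  · simp only [star_trivial, sub_mulVec, dotProduct_sub, sub_nonneg, smul_mulVec, dotProduct_smul, smul_eq_mul]
    set u' : ν' → ℝ := minOp H' Q' *ᵥ v
    have hadm : Q *ᵥ (Qf *ᵥ u') = v := by rw [mulVec_mulVec, ← hcomp]; exact mulVec_minOp h' v
    have h1 := dotProduct_effForm_le_trial hH h hadm
    have h2 := hstab.dotProduct_mulVec_nonneg u'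
    simp only [star_trivial, sub_mulVec, dotProduct_sub, sub_nonneg, smul_mulVec, dotProduct_smul, smul_eq_mul] at h2
    rw [dotProduct_effForm_eq_energy h' v]
    calc v ⬝ᵥ (effForm H Q *ᵥ v) ≤ (Qf *ᵥ u') ⬝ᵥ (H *ᵥ (Qf *ᵥ u')) := h1
      _ = u' ⬝ᵥ ((Qfᵀ * H * Qf) *ᵥ u') := by rw [mulVec_dotProduct_eq, mulVec_mulVec, mulVec_mulVec, Matrix.mul_assoc]
      _ ≤ (1 + ε) * (u' ⬝ᵥ (H' *ᵥ u')) := h2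

/-- **THE ROBUST TWO-LEVEL ENTRY BOUND**: (STAB-ε) + (CONS ≤ κ) + uniform entry bounds `|𝒮_{yy}| ≤ B`, `|𝒮′_{ab}| ≤ B` (`0 ≤ ε`) ⟹
`|𝒮′_{ab} − 𝒮_{ab}| ≤ (1+ε)·κ + 2ε·B` — the slack enters ADDITIVELY, multiplied by the (k-uniform) size of the effective forms. [our proof] -/
theorem abs_effForm_step_le_of_stabSlack_of_cons (hH : H.PosSemidef) (hH' : H'.PosSemidef) (h : IsUnit (kkt H Q).det)
    (h' : IsUnit (kkt H' Q').det) (hcomp : Q' = Q * Qf) (hPQ : Q' * P = Q) {ε κ B : ℝ} (hε : 0 ≤ ε)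
    (hstab : ((1 + ε) • H' - Qfᵀ * H * Qf).PosSemidef)
    (hcons : ∀ y, (minOp H Q *ᵥ Pi.single y 1) ⬝ᵥ ((Pᵀ * H' * P - H) *ᵥ (minOp H Q *ᵥ Pi.single y 1)) ≤ κ)
    (hB : ∀ y, |effForm H Q y y| ≤ B) (hB' : ∀ a b, |effForm H' Q' a b| ≤ B) (a b : c) :
    |effForm H' Q' a b - effForm H Q a b| ≤ (1 + ε) * κ + 2 * ε * B := by
  -- the PSD matrix `D := (1+ε)𝒮′ − 𝒮` has diagonal `≤ εB + (1+ε)κ`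
  have hD := effForm_step_posSemidef_of_stabSlack hH hH' h h' hcomp hstab
  have hdiag : ∀ y, ((1 + ε) • effForm H' Q' - effForm H Q) y y ≤ ε * B + (1 + ε) * κ := fun y => by
    have hstep := effForm_step_diag_le_cons hH' h h' hPQ y
    have hy := (abs_le.mp (hB y)).2
    rw [Matrix.sub_apply, Matrix.smul_apply, smul_eq_mul]
    nlinarith [hcons y, hstep, hy]
  have hDab := abs_apply_le_of_diag_le hD hdiag a b
  rw [Matrix.sub_apply, Matrix.smul_apply, smul_eq_mul] at hDab
  -- `𝒮′_{ab} − 𝒮_{ab} = D_{ab} − ε·𝒮′_{ab}`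
  have hε' : |ε * effForm H' Q' a b| ≤ ε * B := by rw [abs_mul, abs_of_nonneg hε]; exact mul_le_mul_of_nonneg_left (hB' a b) hε
  calc |effForm H' Q' a b - effForm H Q a b|
      = |((1 + ε) * effForm H' Q' a b - effForm H Q a b) - ε * effForm H' Q' a b| := by ring_nf
    _ ≤ |(1 + ε) * effForm H' Q' a b - effForm H Q a b| + |ε * effForm H' Q' a b| := abs_sub _ _
    _ ≤ (ε * B + (1 + ε) * κ) + ε * B := add_le_add hDab hε'
    _ = (1 + ε) * κ + 2 * ε * B := by ring

end Slack

section SlackTower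

variable {c : Type*} [Fintype c] [DecidableEq c]
variable {ι : ℕ → Type*} [∀ j, Fintype (ι j)] [∀ j, DecidableEq (ι j)]
variable {H : ∀ j, Matrix (ι j) (ι j) ℝ} {Qf : ∀ j, Matrix (ι j) (ι (j + 1)) ℝ} {Qc : ∀ j, Matrix c (ι j) ℝ}
variable {P : ∀ j, Matrix (ι (j + 1)) (ι j) ℝ} {cst cε θ B : ℝ}

/-- **`effForm_entry_step_rate_of_stabSlack_of_cons` — THE ROBUST TOWER END** [our proof]: (STAB-ε_j) `(Qf j)ᵀ H_j (Qf j) ≤ (1 + cε·θ^j)·H_{j+1}`,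
(CONS_{j,y}) `≤ cst·θ^j`, and a k-uniform entry bound `|𝒮_j(a,b)| ≤ B` (`0 ≤ cε`, `0 ≤ θ ≤ 1`) ⟹ `|𝒮_{j+1}(a,b) − 𝒮_j(a,b)| ≤ ((1 + cε)·cst + 2·cε·B)·θ^j`. -/
theorem effForm_entry_step_rate_of_stabSlack_of_cons (hH : ∀ j, (H j).PosSemidef) (hk : ∀ j, IsUnit (kkt (H j) (Qc j)).det)
    (hcomp : ∀ j, Qc (j + 1) = Qc j * Qf j) (hPQ : ∀ j, Qc (j + 1) * P j = Qc j) (hcε : 0 ≤ cε) (hcst : 0 ≤ cst)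
    (hθ0 : 0 ≤ θ) (hθ1 : θ ≤ 1)
    (hstab : ∀ j, ((1 + cε * θ ^ j) • H (j + 1) - (Qf j)ᵀ * H j * Qf j).PosSemidef)
    (hcons : ∀ j (y : c), (minOp (H j) (Qc j) *ᵥ Pi.single y 1) ⬝ᵥ
        (((P j)ᵀ * H (j + 1) * P j - H j) *ᵥ (minOp (H j) (Qc j) *ᵥ Pi.single y 1)) ≤ cst * θ ^ j)
    (hB : ∀ j a b, |effForm (H j) (Qc j) a b| ≤ B) :
    ∀ j (a b : c), |effForm (H (j + 1)) (Qc (j + 1)) a b - effForm (H j) (Qc j) a b| ≤ ((1 + cε) * cst + 2 * cε * B) * θ ^ j := by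
  intro j a b
  have hθj : 0 ≤ θ ^ j := pow_nonneg hθ0 j
  have hθj1 : θ ^ j ≤ 1 := pow_le_one₀ hθ0 hθ1
  have hB0 : 0 ≤ B := (abs_nonneg _).trans (hB 0 a b)
  have h := abs_effForm_step_le_of_stabSlack_of_cons (hH j) (hH (j + 1)) (hk j) (hk (j + 1)) (hcomp j) (hPQ j)
    (mul_nonneg hcε hθj) (hstab j) (hcons j) (fun y => hB j y y) (fun a b => hB (j + 1) a b) a b
  refine h.trans ?_
  -- `(1 + cε θ^j)·cst θ^j + 2 cε θ^j B ≤ ((1+cε) cst + 2 cε B) θ^j` since `θ^j ≤ 1`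
  have key : cε * θ ^ j * (cst * θ ^ j) ≤ cε * (cst * θ ^ j) :=
    by nlinarith [mul_nonneg hcε (mul_nonneg hcst hθj)]
  nlinarith [key]

end SlackTower

end Summit.QuantumFields.BalabanUV.Beta.GAN24.DerivativeRateTransferLoewnerKKT

end
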